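import Summits.BirchSwinnertonDyer.BirchSwinnertonDyer.Theorems.CongruentShaFreeCutBDPUpToRigidity
import Summits.BirchSwinnertonDyer.BirchSwinnertonDyer.Theorems.CongruentShaFreeCutTwoAdicBDPTripleUpTo
import HarnessLib

set_option linter.dupNamespace false -- `Summit.BirchSwinnertonDyer.BirchSwinnertonDyer.Theorems.…` (summit = sub)
set_option autoImplicit false

/-!
# Route `CongruentShaFreeCut` (rung S2) — LEMMA R, the READINGS: `L(𝟙) = 0 ⟺ L'(𝟙) = 0` across ♯-frames,
# and the registered ∀-stub `TwoAdicBDPValueAtOneUpTo` ((LB-bdp♯), stmt-BirchSwinnertonDyer-19079) from ONE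
# admissible tuple with the value formula + a character supply

Cell `bsd-cn100`, prover seat `bsd-cn100-transfer` (g11); sibling of
`Theorems/CongruentShaFreeCutBDPUpToRigidity.lean` (LEMMA R = MEMO-transfer-13 §5.4 in Lean:
`[T⁰]L' = (C'/C)·[T⁰]L` across ♯-frames `IsBDPLFunctionUpTo` of the same `(ι, 𝔭, κ, γ, f)`, given the S27
character supply). Supports, does not close, stmt-BirchSwinnertonDyer-19079. THEOREMS ONLY (no definition,
no named fact, no `sorry`). HONEST FRAMING: nothing here proves (LB-exist♯), (LB-wan♯), (LB-bdp♯), crux A,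
crux B, the leaf `rankOne_twoConverse_congruentNumber`, the congruent number problem or any case of BSD; the
two inputs of §2 — ONE admissible tuple WITH the value formula (MEMO-transfer-13 Thm 13.1 + (5.3.1): a
CONSTRUCTION, research-note grade, NOT in the tree) and the character supply (the tree does not construct
Hecke characters of prescribed infinity type) — are HYPOTHESES. PARTITION: none — RANK axis.

## Contents

* §1 (any `p`) the memo's wordings of LEMMA R as corollaries of
  `…CongruentShaFreeCutBDPUpToRigidity.coe_constantCoeff_eq_mul_of_isBDPLFunctionUpTo_of_supply`:
  `constantCoeff_eq_zero_iff_of_isBDPLFunctionUpTo_of_supply` (`L(𝟙) = 0 ⟺ L'(𝟙) = 0`) and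
  `constantCoeff_eq_of_isBDPLFunctionUpTo_of_supply` (`C' = C` ⟹ `[T⁰]L' = [T⁰]L` in `R₀`; at `C = C' = 1`
  this is S27 `…X11b.constantCoeff_eq_of_isBDPLFunction_of_supply` again, `isBDPLFunctionUpTo_one_iff`).
* §2 (`p = 2`) **`twoAdicBDPValueAtOneUpTo_of_frameValue_of_supply`** — the REGISTERED ∀-form
  `…CongruentShaFreeCutTwoAdicBDPTripleUpTo.TwoAdicBDPValueAtOneUpTo` (= `stub_twoAdicBDPValueAtOneUpTo` of
  line `heegner-field-bdp-triple-upto` v6cp on stmt-BirchSwinnertonDyer-19079) FROM (h12♯) "for every datum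
  and every `ι'` inducing `v`, ONE admissible `(Ω_K, Ω_p, C, 𝓛)` with `IsBDPLFunctionUpTo C …` AND
  `𝓛(𝟙) = u·c⁻²·(1 − a₂2⁻¹ + [2∤N]2⁻¹)²·(log_ω P)²`, `u ≠ 0`" (the ∃∧-form: what MEMO-transfer-13 §§2–5.3
  WRITES) + (hsup) a character supply at every `(K, ι', κ, γ)` of the stub's data (the
  `…X11b.Three.bdpValueAt₃_of_frameValue_of_supply` pattern at `p = 2`). This is MEMO-transfer-13's THEOREM
  13.2 ⟸ 13.1 + (5.3.1) + LEMMA R, kernel-checked: the ∀-quantifier over admissible tuples in the typed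
  (LB-bdp♯) costs exactly the supply, nothing else.

References: [Castella2018] Thm. 3.1–3.2 (arXiv:1704.06608 pp. 8–9); [CastellaHsieh2018] §3.3, Def. 3.5,
Prop. 3.6; [BertoliniDarmonPrasanna2013] Thm. 5.13 (shape of the value at `𝟙`); [Cassels1986] Ch. 4.
-/

noncomputable section

open scoped Classical Topology

open Filter PowerSeries WeierstrassCurve NumberField IsDedekindDomain Field
  Literature.NumberTheory.EllipticCurves Literature.NumberTheory.EllipticCurves.ModularForms
  Literature.NumberTheory.QuadraticFields Literature.NumberTheory.EllipticCurves.Castella2018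
  Literature.NumberTheory.GaloisRepresentations Literature.NumberTheory.GaloisCohomology

namespace Summit.BirchSwinnertonDyer.BirchSwinnertonDyer.Theorems.CongruentShaFreeCutBDPUpToRigidity

/-! ### §1 LEMMA R in the memo's wordings (any prime `p`) -/

section AnyPrime

variable {p : ℕ} [Fact p.Prime]

/-- **LEMMA R in the memo's wording: `L(𝟙) = 0 ⟺ L'(𝟙) = 0`** for two ♯-frames of the same
`(ι, 𝔭, κ, γ, f)` with non-zero periods and constants, given the character supply (corollary of
`coe_constantCoeff_eq_mul_of_isBDPLFunctionUpTo_of_supply`: `[T⁰]L' = (C'/C)·[T⁰]L` with `C'/C ≠ 0`).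
[cite: Castella2018, Thm. 3.1–3.2 (arXiv:1704.06608 pp. 8–9) (interpolation shape; the rigidity statement is elementary p-adic analysis on R₀⟦T⟧)] -/
theorem constantCoeff_eq_zero_iff_of_isBDPLFunctionUpTo_of_supply (K : Type) [Field K] [NumberField K]
    (N : ℕ) (ι : PadicAlgCl p ≃+* ℂ) (𝔭 : HeightOneSpectrum (𝓞 K)) (κ : ZpExtension K p)
    (γ : Field.absoluteGaloisGroup K) (f : CuspForm (CongruenceSubgroup.Gamma0 N) 2) (ΩK ΩK' : ℂ)
    (Ωp Ωp' C C' : ℂ_[p]) (L L' : UnrSeries p) (m : ℕ) (x₀ : ℂ_[p]) (φ φ' : ℕ → HeckeCharacter K)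
    (r r' : ℕ → FramedGaloisRep K (PadicAlgCl p) 1)
    (hm : 0 < m) (hx : Tendsto (fun k ↦ x₀ ^ p ^ k) atTop (𝓝 1))
    (hunr : ∀ k (v : HeightOneSpectrum (𝓞 K)), (φ k).IsUnramifiedAt v)
    (hinf : ∀ k, (φ k).HasInfinityType (fun _ ↦ ((m * p ^ k : ℕ) : ℤ))
      (fun _ ↦ -((m * p ^ k : ℕ) : ℤ)))
    (hr : ∀ k, IsPAdicAvatarOf ι (φ k) (r k)) (hrκ : ∀ k, FactorsThroughZp κ (r k))
    (hval : ∀ k, avatarValueAt (r k) γ = x₀ ^ p ^ k)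
    (hunr' : ∀ k (v : HeightOneSpectrum (𝓞 K)), (φ' k).IsUnramifiedAt v)
    (hinf' : ∀ k, (φ' k).HasInfinityType (fun _ ↦ ((2 * m * p ^ k : ℕ) : ℤ))
      (fun _ ↦ -((2 * m * p ^ k : ℕ) : ℤ)))
    (hr' : ∀ k, IsPAdicAvatarOf ι (φ' k) (r' k)) (hrκ' : ∀ k, FactorsThroughZp κ (r' k))
    (hval' : ∀ k, avatarValueAt (r' k) γ = x₀ ^ (2 * p ^ k))
    (hΩK : ΩK ≠ 0) (hΩK' : ΩK' ≠ 0) (hΩp : Ωp ≠ 0) (hΩp' : Ωp' ≠ 0) (hC : C ≠ 0) (hC' : C' ≠ 0)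
    (hL : IsBDPLFunctionUpTo C ι 𝔭 κ γ f ΩK Ωp L)
    (hL' : IsBDPLFunctionUpTo C' ι 𝔭 κ γ f ΩK' Ωp' L') :
    PowerSeries.constantCoeff L = 0 ↔ PowerSeries.constantCoeff L' = 0 := by
  have key := coe_constantCoeff_eq_mul_of_isBDPLFunctionUpTo_of_supply K N ι 𝔭 κ γ f ΩK ΩK' Ωp Ωp'
    C C' L L' m x₀ φ φ' r r' hm hx hunr hinf hr hrκ hval hunr' hinf' hr' hrκ' hval' hΩK hΩK' hΩp hΩp'
    hC hC' hL hL'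
  have e1 : PowerSeries.constantCoeff L = 0 ↔
      ((PowerSeries.constantCoeff L : unrIntegers p) : ℂ_[p]) = 0 := ZeroMemClass.coe_eq_zero.symm
  have e2 : PowerSeries.constantCoeff L' = 0 ↔
      ((PowerSeries.constantCoeff L' : unrIntegers p) : ℂ_[p]) = 0 := ZeroMemClass.coe_eq_zero.symm
  rw [e1, e2, key, mul_eq_zero, or_iff_right (div_ne_zero hC' hC)]

/-- **The same constant (`C' = C`) ⟹ the same value at `𝟙` in `R₀`** (across periods): for `C = C' = 1`
this is S27 (`…X11b.constantCoeff_eq_of_isBDPLFunction_of_supply`) again, by `isBDPLFunctionUpTo_one_iff`.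
[cite: Castella2018, Thm. 3.1–3.2 (arXiv:1704.06608 pp. 8–9) (interpolation shape; the rigidity statement is elementary p-adic analysis on R₀⟦T⟧)] -/
theorem constantCoeff_eq_of_isBDPLFunctionUpTo_of_supply (K : Type) [Field K] [NumberField K]
    (N : ℕ) (ι : PadicAlgCl p ≃+* ℂ) (𝔭 : HeightOneSpectrum (𝓞 K)) (κ : ZpExtension K p)
    (γ : Field.absoluteGaloisGroup K) (f : CuspForm (CongruenceSubgroup.Gamma0 N) 2) (ΩK ΩK' : ℂ)
    (Ωp Ωp' C : ℂ_[p]) (L L' : UnrSeries p) (m : ℕ) (x₀ : ℂ_[p]) (φ φ' : ℕ → HeckeCharacter K)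
    (r r' : ℕ → FramedGaloisRep K (PadicAlgCl p) 1)
    (hm : 0 < m) (hx : Tendsto (fun k ↦ x₀ ^ p ^ k) atTop (𝓝 1))
    (hunr : ∀ k (v : HeightOneSpectrum (𝓞 K)), (φ k).IsUnramifiedAt v)
    (hinf : ∀ k, (φ k).HasInfinityType (fun _ ↦ ((m * p ^ k : ℕ) : ℤ))
      (fun _ ↦ -((m * p ^ k : ℕ) : ℤ)))
    (hr : ∀ k, IsPAdicAvatarOf ι (φ k) (r k)) (hrκ : ∀ k, FactorsThroughZp κ (r k))
    (hval : ∀ k, avatarValueAt (r k) γ = x₀ ^ p ^ k)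
    (hunr' : ∀ k (v : HeightOneSpectrum (𝓞 K)), (φ' k).IsUnramifiedAt v)
    (hinf' : ∀ k, (φ' k).HasInfinityType (fun _ ↦ ((2 * m * p ^ k : ℕ) : ℤ))
      (fun _ ↦ -((2 * m * p ^ k : ℕ) : ℤ)))
    (hr' : ∀ k, IsPAdicAvatarOf ι (φ' k) (r' k)) (hrκ' : ∀ k, FactorsThroughZp κ (r' k))
    (hval' : ∀ k, avatarValueAt (r' k) γ = x₀ ^ (2 * p ^ k))
    (hΩK : ΩK ≠ 0) (hΩK' : ΩK' ≠ 0) (hΩp : Ωp ≠ 0) (hΩp' : Ωp' ≠ 0) (hC : C ≠ 0)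
    (hL : IsBDPLFunctionUpTo C ι 𝔭 κ γ f ΩK Ωp L)
    (hL' : IsBDPLFunctionUpTo C ι 𝔭 κ γ f ΩK' Ωp' L') :
    PowerSeries.constantCoeff L' = PowerSeries.constantCoeff L := by
  have key := coe_constantCoeff_eq_mul_of_isBDPLFunctionUpTo_of_supply K N ι 𝔭 κ γ f ΩK ΩK' Ωp Ωp'
    C C L L' m x₀ φ φ' r r' hm hx hunr hinf hr hrκ hval hunr' hinf' hr' hrκ' hval' hΩK hΩK' hΩp hΩp'
    hC hC hL hL'
  rw [div_self hC, one_mul] at key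
  exact Subtype.ext key

end AnyPrime

/-! ### §2 The registered ∀-form (LB-bdp♯) `TwoAdicBDPValueAtOneUpTo` from ONE tuple with the value
formula + a character supply (`p = 2`) -/

open Summit.BirchSwinnertonDyer.BirchSwinnertonDyer.Theorems.CongruentShaFreeCutTwoAdicBDPTripleUpTo
  (TwoAdicBDPValueAtOneUpTo)

/-- **MEMO-transfer-13 THEOREM 13.2 ⟸ THEOREM 13.1 + (5.3.1) + LEMMA R, kernel-checked at `p = 2`: the
REGISTERED ∀-stub (LB-bdp♯) `TwoAdicBDPValueAtOneUpTo` follows from**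
(h12♯) for every datum of the stub and every embedding datum `ι'` inducing `v`, ONE admissible tuple
`(Ω_K, Ω_p, C, 𝓛)` (`Ω_K ≠ 0`, `Ω_p ∈ R₀ˣ`, `C ≠ 0`, `IsBDPLFunctionUpTo C ι' v κ γ f Ω_K Ω_p 𝓛`) WITH the
value formula `𝓛(𝟙) = u · c⁻² · (1 − a₂·2⁻¹ + [2 ∤ N]·2⁻¹)² · (log_ω P)²`, `u ∈ ℂ₂, u ≠ 0` — the ∃∧-form,
i.e. what MEMO-transfer-13 §§2–5.3 WRITES (a construction; research-note grade; a HYPOTHESIS here) —, and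
(hsup) a CHARACTER SUPPLY at every `(K, ι', κ, γ)` with `K` imaginary quadratic, `κ` anticyclotomic and
`γ` a topological generator — `m > 0`, `x₀` with `x₀^(2^k) → 1` (and `≠ 1`, not used), interpolation data
of infinity types `m·2^k`, `2m·2^k` with avatars through `κ` and avatar values `x₀^(2^k)`, `x₀^(2·2^k)`
(the binders of `…X11b.Three.bdpValueAt₃_of_frameValue_of_supply` at `p = 2`; a HYPOTHESIS: the tree does
not construct Hecke characters of prescribed infinity type). PROOF: at the given admissible
`(Ω_K', Ω_p', C', 𝓛')`, LEMMA R (`coe_constantCoeff_eq_mul_of_isBDPLFunctionUpTo_of_supply`) against the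
witness tuple gives `𝓛'(𝟙) = (C'/C)·𝓛(𝟙) = ((C'/C)·u)·c⁻²·(…)²·(log_ω P)²` with `(C'/C)·u ≠ 0`. So the
∀-quantifier of the typed (LB-bdp♯) costs exactly the supply. CONDITIONAL; credits nothing.
[cite: Castella2018, Thm. 3.1–3.2 (arXiv:1704.06608 pp. 8–9) (shape only; nothing asserted)]
[cite: BertoliniDarmonPrasanna2013, Thm. 5.13 (shape of the value at the trivial character; nothing asserted)] -/
theorem twoAdicBDPValueAtOneUpTo_of_frameValue_of_supply
    (hsup : ∀ (K : Type) [Field K] [NumberField K] (ι : PadicAlgCl 2 ≃+* ℂ) (κ : ZpExtension K 2)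
      (γ : Field.absoluteGaloisGroup K), IsImaginaryQuadratic K → κ.IsAnticyclotomic →
      κ.IsTopGenerator γ →
      ∃ (m : ℕ) (x₀ : ℂ_[2]) (φ φ' : ℕ → HeckeCharacter K)
        (r r' : ℕ → FramedGaloisRep K (PadicAlgCl 2) 1),
        0 < m ∧ (∀ k, x₀ ^ 2 ^ k ≠ 1) ∧ Tendsto (fun k ↦ x₀ ^ 2 ^ k) atTop (𝓝 1) ∧
        (∀ k (v : HeightOneSpectrum (𝓞 K)), (φ k).IsUnramifiedAt v) ∧
        (∀ k, (φ k).HasInfinityType (fun _ ↦ ((m * 2 ^ k : ℕ) : ℤ))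
          (fun _ ↦ -((m * 2 ^ k : ℕ) : ℤ))) ∧
        (∀ k, IsPAdicAvatarOf ι (φ k) (r k)) ∧ (∀ k, FactorsThroughZp κ (r k)) ∧
        (∀ k, avatarValueAt (r k) γ = x₀ ^ 2 ^ k) ∧
        (∀ k (v : HeightOneSpectrum (𝓞 K)), (φ' k).IsUnramifiedAt v) ∧
        (∀ k, (φ' k).HasInfinityType (fun _ ↦ ((2 * m * 2 ^ k : ℕ) : ℤ))
          (fun _ ↦ -((2 * m * 2 ^ k : ℕ) : ℤ))) ∧
        (∀ k, IsPAdicAvatarOf ι (φ' k) (r' k)) ∧ (∀ k, FactorsThroughZp κ (r' k)) ∧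
        (∀ k, avatarValueAt (r' k) γ = x₀ ^ (2 * 2 ^ k)))
    (h12 : ∀ ⦃n : ℕ⦄, Squarefree n →
      ∀ [(congruentNumberCurve n).IsElliptic] [(congruentNumberCurve n).IsGloballyMinimal]
        (ι' : PadicAlgCl 2 ≃+* ℂ) (K : Type) [Field K] [NumberField K] (N : ℕ) [NeZero N]
        (Dt : ModularParametrizationData (congruentNumberCurve n) N)
        (H : HeegnerDatum N (NumberField.discr K)) (w : InfinitePlace K) (e : K →+* ℚ_[2])
        (v : HeightOneSpectrum (𝓞 K)) (κ : ZpExtension K 2) (γ : absoluteGaloisGroup K)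
        [Fact (κ.IsTopGenerator γ)] (P : ((congruentNumberCurve n).baseChange K).toAffine.Point),
      (congruentNumberCurve n).conductorNorm ℤ = N → IsImaginaryQuadratic K →
      SatisfiesHeegnerHypothesis N K → ((Ideal.span {(2 : ℤ)}).primesOver (𝓞 K)).ncard = 2 →
      ((2 : ℕ) : 𝓞 K) ∈ v.asIdeal →
      (∀ (w' : InfinitePlace K) (k : 𝓞 K), k ∈ v.asIdeal ↔ ‖ι'.symm (w'.embedding (k : K))‖ < 1) →
      κ.IsAnticyclotomic →
      WeierstrassCurve.Affine.Point.map w.embedding.toRatAlgHom P = heegnerPointComplex Dt H →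
      (∀ k : 𝓞 K, k ∈ v.asIdeal ↔ ‖e (k : K)‖ < 1) →
      ∃ (ΩK : ℂ) (Ωp : (unrIntegers 2)ˣ) (C : ℂ_[2]) (L : UnrSeries 2),
        ΩK ≠ 0 ∧ C ≠ 0 ∧ IsBDPLFunctionUpTo C ι' v κ γ Dt.f ΩK ((Ωp : unrIntegers 2) : ℂ_[2]) L ∧
        ∃ u : ℂ_[2], u ≠ 0 ∧ L.HasValueAt 0
          (u * algebraMap ℚ_[2] ℂ_[2] (((Dt.c : ℚ_[2])⁻¹) ^ 2 *
            (1 - ((congruentNumberCurve n).LFunction 2 : ℚ_[2]) * (2 : ℚ_[2])⁻¹ +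
              (if (2 : ℕ) ∣ N then 0 else (2 : ℚ_[2])⁻¹)) ^ 2 *
            (padicLogOmega (congruentNumberCurve n) 2 e P) ^ 2))) :
    TwoAdicBDPValueAtOneUpTo := by
  intro n hn _ _ ι' K _ _ N _ Dt H w e v κ γ hγ P hN hK hH h2 hv2 hι' hκ hP he ΩK' Ωp' C' L' hΩK'
    hC' hL'
  obtain ⟨ΩK, Ωp, C, L, hΩK, hC, hL, u, hu0, hu⟩ :=
    h12 hn ι' K N Dt H w e v κ γ P hN hK hH h2 hv2 hι' hκ hP he
  have hΩp : ((Ωp : unrIntegers 2) : ℂ_[2]) ≠ 0 := by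
    rw [Ne, ZeroMemClass.coe_eq_zero]
    exact Units.ne_zero Ωp
  have hΩp' : ((Ωp' : unrIntegers 2) : ℂ_[2]) ≠ 0 := by
    rw [Ne, ZeroMemClass.coe_eq_zero]
    exact Units.ne_zero Ωp'
  obtain ⟨m, x₀, φ, φ', r, r', hm, -, hxlim, hunr, hinf, hr, hrκ, hval, hunr', hinf', hr', hrκ',
    hval'⟩ := hsup K ι' κ γ hK hκ hγ.out
  have key : ((PowerSeries.constantCoeff L' : unrIntegers 2) : ℂ_[2]) =
      C' / C * ((PowerSeries.constantCoeff L : unrIntegers 2) : ℂ_[2]) :=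
    coe_constantCoeff_eq_mul_of_isBDPLFunctionUpTo_of_supply K N ι' v κ γ Dt.f ΩK ΩK' _ _ C C' L L'
      m x₀ φ φ' r r' hm hxlim hunr hinf hr hrκ hval hunr' hinf' hr' hrκ' hval' hΩK hΩK' hΩp hΩp' hC
      hC' hL hL'
  have hcu := UnrSeries.eq_constantCoeff_of_hasValueAt_zero hu
  refine ⟨C' / C * u, mul_ne_zero (div_ne_zero hC' hC) hu0, ?_⟩
  have h0 := L'.hasValueAt_zero
  rw [key, ← hcu, ← mul_assoc] at h0
  exact h0

end Summit.BirchSwinnertonDyer.BirchSwinnertonDyer.Theorems.CongruentShaFreeCutBDPUpToRigidity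

end
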